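import Summits.QuantumFields.BalabanUV.T4Continuum.Support.B13StepOfRecordSecantStructuralSub
import Summits.QuantumFields.BalabanUV.T4Continuum.Support.OutputRateWindow

/-!
# NE5 ∕ U3 — THE STRUCTURAL SECANT END OF RECORD RE-POINTED OVER A SUB-SLOT (E8[rec,structural,sub], N150 p217039) WITH THE LEAF-L10 LETTERS
# `k₀`, `B`, `E₁` ELIMINATED AND `∃ C₅` OUTERMOST — ONE constant from the SIZES for every pair of runs, slot package, sub-slot, cores, window,
# class, majorants and insertion-composition data — AND ITS WINDOWWISE FORM (row owner's rulings R24 × R29′)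

Cell `pub-balaban`, unit `b2b-balaban-t4-ne5-formalise-leaf-01` (NE5 formalisation swarm, LEAF PROVER 01, gen 8; journal INTENT `CLAIMS.log`
l.13363; CLAIM RULE 1 — a FOLLOWER of this lineage's `B13StepOfRecordSecantStructural` p214566 (N111) ∕ `B13StepOfRecordSecantStructuralSub`
p217039 (N150), pattern of leaf-10's `B13StepSecantArithmetic` (N80) ∕ `B13StepEndSubArithmetic` (p218097) and leaf-03's
`B13StepEnvelopeEndUniform` (p218872)).  Summits-side NEW WORK under the LEAN PLACEMENT RULE (cell bookkeeping; 0 `def`, 0 cite tag); nothing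
landed is edited.  HONEST FRAMING: rung (B)+1 of the FINITE-VOLUME T⁴ continuum programme — NOT infinite volume, NOT a mass gap, NOT the Clay problem,
and **NOT A PROOF OF NE5, NOR OF W2-op, NOR OF W2-ins** (NE5 is NOT PRINTED in [Balaban1987RG1]–[Balaban1989LargeFieldII], which print
ε-UNIFORM bounds, never η-RATES; GAPS G-t4-U3-1; both W2 walls stay RELOCATED TO STRUCTURE exactly as in p214566 ∕ p217039 — locators of
KIND only there: [Balaban1988RG2Cluster] (2.15)–(2.17) pp. 15–16, Lemma 1 (1.34)∕(1.36) p. 9, Lemma 3 (2.38) p. 20; [Balaban1987RG1]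
(1.9)∕(1.18) pp. 261∕263): every theorem below is an IMPLICATION whose wall binders — the transport reading; the one-run slice budgets (W3
KIND); the quoted levels L05∕L06; W1 in row NE2's entry currency; the insertion COMPOSITION shape + datum membership + insertion rate + reach
(W2-ins ∕ W4 KIND); **`ActOpFibre` over operator lines IN the sub-slot** with decay split and (2.38) shape (W2-op KIND); the history side's
per-activity STRUCTURE `ActExpLinearOn`, exponent bounds, absolute majorants with decay split and (2.38) shape; the radii — are DISPLAYED
HYPOTHESES, asserted nowhere.  HONEST DEPENDENCY (cell line, verbatim): continuum YM on T⁴ ⇐ BetaPertH ∧ nine spine estimates (0/9 proved);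
BetaPertH ⇐ (D1) ∧ (D4) ∧ CAP+tail; G-an2-4 gates asym, D1 and NE2/3/4.

WHAT THIS FILE DOES (compositions BY NAME; no estimate of its own).  In the structural secant END of record (p214566 §2, re-pointed over a
sub-slot `M ≤ OpDatum E` by p217039 §3 — of record `M := measOp`, ruling R20 (i)) the constant
`C₅ = ((Φ″(εop)∕(1−ρ₀))·(c₁∕r₀) + 2·N̄·Φ″(ε)·(Gi·δI∕(1−ρ₁) + 2·Gi∕θ^{k₁}) + B)·(θ′ − ω) ∕ (θ′ − (ω + 2·N̄·Φ″(ε)·cA))`,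
`Φ″(ε) := ε·e^{64}·K₀ ∕ (1 − 36·ε·e^{64}·K₀)²`, depends on the displayed SIZES only — never on the pair of runs `R : B13Carriers.TwoRuns 𝔾`
(the two lattice spacings), the slot package `S₀`, the sub-slot `M`, the cores, the window `W`, the class radii, the majorants `N, A, A′,
Aop, Aop′`, the datum `Dt` or the insertion-composition data.  The operator reach `0 < ρ₀ < 1` is a SIZE here (it is TIED to the fibre
modulus `1∕(1−ρ₀)`, p214566 §1); the eliminable letters are leaf L10's reach scale `k₀` (`(c₁∕r₀)·θ^{k₀} ≤ ρ₀`), the first-scales constant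
`B` and the free reference level `E₁ := 1` (`OutputRateArithmetic.reach_scale_exists`, `OutputRateResidual.first_scales_const` BY NAME —
exactly as in p217039 §5, whose `∃ C₅` however sits AFTER the window and is TERMINAL for it by R29, `OutputRateWindowBounded`).  So:
* §1 **`uniform_ne5_of_record_onSub_secant_structural`** — p217039 §3's first face (cores `act` typed on `↥M`, `onSub S₀ M hMA hMB act`)
  with `∃ C₅` OUTERMOST: `∃ C₅, ∀ R S₀ M hMA hMB act W ROp RHist N A A′ Aop Aop′ Dt rI cfg Φ 𝒪 Dc, S₀.D.ω = ω → ⋯ →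
  NE5 (outA (onSub S₀ M hMA hMB act) E₀ cB) (outB (onSub …) E₀ cB) W κ θ′ C₅`;
* §2 **`uniform_ne5_of_record_restrict_secant_structural`** — the same for the cores OF RECORD read through the inclusion
  (`restrict S₀ M hMA hMB`): root LITERALLY `NE5 (B13StepOfRecord.outA S₀ E₀ cB) (B13StepOfRecord.outB S₀ E₀ cB) W κ θ′ C₅`; and
  **`uniform_ne5_of_record_restrict_secant_lineAnalytic`** — the η-uniform form of p217039 §4 (the Cauchy route's factor datum
  `ActOpLineAnalyticOn` over operator segments IN `M` + norm majorant + ROOM in place of `ActOpFibre`: the ONE W2-op binder leaf-03's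
  η-uniform E9[rec,sub] face p218872 §3 reads too);
* §3 **`uniform_ne5_of_record_restrict_secant_structural_singleton`** — §2 read WINDOWWISE (R24 × R29′ (a)): every window-dependent
  binder supplied at the singleton window `{g}`, `g ∈ W`, with g-INDEXED dictionaries `N g, A g, A′ g, Aop g, Aop′ g, Dt g` and
  insertion-composition data `cfg g, Φ g, 𝒪 g, Dc g`, COMMON sizes, the SAME `C₅` (`OutputRateWindow.ne5_of_forall_singleton`).
CENSUS vs p217039 §3∕§4: MINUS = [hE₁, hreach, hB, hfirst] + letters `E₁, k₀, B`; PLUS = [hθ1 : θ < 1], `0 < ρ₀`; every other binder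
VERBATIM, now AFTER `∃ C₅`.  Nothing asserted about [II]'s kernels ∕ potentials ∕ terms; 0 sorry; axioms ⊆ {propext, Classical.choice, Quot.sound}.
-/

noncomputable section

open Metric Set MeasureTheory
namespace Summit.QuantumFields.BalabanUV.T4Continuum.B13StepOfRecordSecantStructuralUniform

open Literature.MathematicalPhysics.QuantumFieldTheory.Balaban1983to89
open Literature.MathematicalPhysics.QuantumFieldTheory.Balaban1983to89.T4OutputRate (DecayBound NE5)
open Literature.MathematicalPhysics.QuantumFieldTheory.Balaban1983to89.T4InputCauchyRateSpecies (ballClass)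
open Summit.QuantumFields.BalabanUV.T4Continuum.B13Carriers (TwoRuns)
open Summit.QuantumFields.BalabanUV.T4Continuum.B13OpDatum (OpDatum)
open Summit.QuantumFields.BalabanUV.T4Continuum.B13OpDatumJunctions (opOf RawBounded WeightedEntrywiseRate)
open Summit.QuantumFields.BalabanUV.T4Continuum.B13StepTermLabels (InnerLabel)
open Summit.QuantumFields.BalabanUV.T4Continuum.B13StepTermFamily (ActData ActExpLinearOn)
open Summit.QuantumFields.BalabanUV.T4Continuum.B13StepTermSocket (labelsIndexing)
open Summit.QuantumFields.BalabanUV.T4Continuum.B13InnerData (Bnd b13InnerData)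
open Summit.QuantumFields.BalabanUV.T4Continuum.UrsellTermBudget (actSum)
open Summit.QuantumFields.BalabanUV.T4Continuum.B13TermHistSecant (ActExpNormBound ActAbsBound)
open Summit.QuantumFields.BalabanUV.T4Continuum.B13DomainGeometryTR (domainGeometry)
open Summit.QuantumFields.BalabanUV.T4Continuum.B13Base (selfCtr)
open Summit.QuantumFields.BalabanUV.T4Continuum.B13StepOfRecord (Slots assembly step)
open Summit.QuantumFields.BalabanUV.T4Continuum.OutputRateActOpFibre (ActOpFibre)
open Summit.QuantumFields.BalabanUV.T4Continuum.OutputRateInsertionStructural (InsOpComposition)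
open Summit.QuantumFields.BalabanUV.T4Continuum.B13StepOfRecordSub (assemblyOn stepOn onSub restrict)
open Summit.QuantumFields.BalabanUV.T4Continuum.B13TermOpEnvelope (ActOpLineAnalyticOn)
open Summit.QuantumFields.BalabanUV.T4Continuum.B13StepOfRecordSecantStructuralSub (ne5_of_record_onSub_secant_structural
  ne5_of_record_restrict_secant_structural ne5_of_record_restrict_secant_lineAnalytic)
open Summit.QuantumFields.BalabanUV.T4Continuum.OutputRateArithmetic (reach_scale_exists)
open Summit.QuantumFields.BalabanUV.T4Continuum.OutputRateWindow (ne5_of_forall_singleton)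

/-! ## §1 E8[rec,structural] on a sub-slot, cores typed on `↥M`: one constant for every pair of runs, sub-slot and core family -/

section OnSub

/-- [folklore] **THE STRUCTURAL SECANT END OF RECORD ON A SUB-SLOT (CORES ON `↥M`) WITH A CONSTANT UNIFORM IN THE PAIR OF RUNS, THE
SUB-SLOT AND THE CORES.**  Fix the displayed SIZES `κ, N̄, ε, εop ≥ 0`, `Rt ≥ 64·log 162 + 64`, `36·Φ(ε) < 1`, `36·Φ(εop) < 1`
(`Φ(ε) = ε·e^{64}·K₀`), `EA₀, E₀, cA, cB, c₁ ≥ 0`, `r₀ > 0`, the insertion letters `Gi, δI ≥ 0`, `ρ₁ < 1`, `k₁` with `δI·θ^{k₁} ≤ ρ₁`,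
`0 < θ < 1`, `θ ≤ θ′ ≤ 1`, `0 < ω < 1`, operator reach `0 < ρ₀ < 1` — subject to the ONE strict size inequality `ω + 2·N̄·Φ″(ε)·cA < θ′`.
Then ONE constant `C₅` serves EVERY pair of runs `R : B13Carriers.TwoRuns 𝔾`, slot package `S₀` with `S₀.D.ω = ω`, sub-slot `M ∋` both
runs' operator data of record, core family `act` on `↥M`, window `W`, class radii, majorants `N, A, A′, Aop, Aop′`, datum `Dt`, insertion
radii and insertion-composition data: the displayed binders of `B13StepOfRecordSecantStructuralSub.ne5_of_record_onSub_secant_structural`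
(reading; slice budgets; the quoted levels for the sub-slot model's outputs; `RawBounded` ×2 + `WeightedEntrywiseRate … c₁ θ^k` + floor;
`InsOpComposition` + datum membership + `InsOpRate`; **`ActOpFibre` for `act` over operator lines IN `M`** with decay split + (2.38) shape;
`ActExpLinearOn` ∕ `ActExpNormBound` ∕ `ActAbsBound` on the sub-slot ball class with decay split + (2.38) shape; radii) IMPLY
`NE5 (outA (onSub S₀ M hMA hMB act) E₀ cB) (outB (onSub …) E₀ cB) W κ θ′ C₅`.  The η-uniformity is the quantifier order
`∃ C₅, ∀ R S₀ M act W …`.  NOT a proof of NE5: an implication from displayed binders. -/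
theorem uniform_ne5_of_record_onSub_secant_structural {κ Nbar ε εop Rt EA₀ E₀ cA cB c₁ r₀ Gi δI ρ₁ θ θ' ω ρ₀ : ℝ} {k₁ : ℕ}
    (hκ : 0 ≤ κ) (hNbar : 0 ≤ Nbar) (hε : 0 ≤ ε) (hεop : 0 ≤ εop) (hRt : 64 * Real.log 162 + 64 ≤ Rt)
    (hΦsmall : 36 * (ε * Real.exp 64 * B12TreeDecay.K₀ (4 * 2 ^ 4) (2 * 4)) < 1)
    (hΦopsmall : 36 * (εop * Real.exp 64 * B12TreeDecay.K₀ (4 * 2 ^ 4) (2 * 4)) < 1)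
    (hEA₀ : 0 ≤ EA₀) (hE₀ : 0 ≤ E₀) (hcA : 0 ≤ cA) (hcB : 0 ≤ cB) (hc₁ : 0 ≤ c₁) (hr₀ : 0 < r₀)
    (hGi : 0 ≤ Gi) (hδI : 0 ≤ δI) (hρ₁ : ρ₁ < 1) (hreachI : δI * θ ^ k₁ ≤ ρ₁)
    (hθ0 : 0 < θ) (hθ1 : θ < 1) (hθθ' : θ ≤ θ') (hθ'1 : θ' ≤ 1) (hω : 0 < ω) (hω1 : ω < 1) (hρ₀ : 0 < ρ₀) (hρ₀1 : ρ₀ < 1)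
    (hsmall : ω + 2 * (Nbar * ((ε * Real.exp 64 * B12TreeDecay.K₀ (4 * 2 ^ 4) (2 * 4)) /
          (1 - 36 * (ε * Real.exp 64 * B12TreeDecay.K₀ (4 * 2 ^ 4) (2 * 4))) ^ 2)) * cA < θ') :
    ∃ C₅ : ℝ, ∀ {𝔾 : Type} [GaugeGroup 𝔾] {R : TwoRuns 𝔾} {E IOp Hist Ω : Type*} [NormedAddCommGroup Hist] [NormedSpace ℂ Hist]
      [CompleteSpace Hist] [NormedAddCommGroup IOp] [NormedSpace ℂ IOp] [MeasurableSpace Ω] (S₀ : Slots R E IOp Hist)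
      (M : Submodule ℂ (OpDatum E)) (hMA : ∀ g V k, opOf S₀.F S₀.rawA g V k ∈ M) (hMB : ∀ g U k, opOf S₀.F S₀.rawB g U k ∈ M)
      (act : R.carriers.Dom → InnerLabel R.carriers.Dom (Bnd R) → M → Hist → ℂ)
      {W : Set (ℕ → ℝ)} {ROp RHist : ℕ → ℝ}
      {N A A' Aop Aop' : ℕ → (ℕ → ℝ) → R.carriers.BgB → R.carriers.Dom → InnerLabel R.carriers.Dom (Bnd R) → ℝ}
      {Dt : ActData R.carriers.Dom (InnerLabel R.carriers.Dom (Bnd R)) M Hist Ω} {rI : ℕ → ℝ} {hrI : ∀ k, 0 < rI k}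
      {Cfg : ℕ → Type*} [∀ k, NormedAddCommGroup (Cfg k)] [∀ k, NormedSpace ℂ (Cfg k)] {cfg : ∀ k, IOp → Cfg k}
      {Φ : ∀ k, (R.carriers.Dom → ℝ) → Cfg k → Hist} {𝒪 : ℕ → (ℕ → ℝ) → R.carriers.BgB → Set IOp}
      {Dc : ∀ k, (ℕ → ℝ) → R.carriers.BgB → Set (Cfg k)},
      S₀.D.ω = ω →
      (assembly S₀).TransportReads W →
      (assembly S₀).SliceBudgetB W κ cB → S₀.D.SliceBudget (step S₀ E₀ cB) W κ cA →
      DecayBound (B13StepOfRecordSub.outA (onSub S₀ M hMA hMB act) E₀ cB) W EA₀ κ →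
      DecayBound (B13StepOfRecordSub.outB (onSub S₀ M hMA hMB act) E₀ cB) W E₀ κ →
      RawBounded S₀.F (assembly S₀).rawAt W → RawBounded S₀.F S₀.rawB W →
      WeightedEntrywiseRate S₀.F (assembly S₀).rawAt S₀.rawB W c₁ (fun k => θ ^ k) → (∀ k, r₀ ≤ S₀.rOp k) →
      InsOpComposition (S₀.D.toInsOpModel (step S₀ E₀ cB) rI hrI) W κ E₀ Gi cfg Φ 𝒪 Dc →
      (∀ k, ∀ g ∈ W, ∀ (U : R.carriers.BgB), (S₀.D.toInsOpModel (step S₀ E₀ cB) rI hrI).opIA g U k ∈ 𝒪 k g U) →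
      (S₀.D.toInsOpModel (step S₀ E₀ cB) rI hrI).InsOpRate W δI θ →
      ActOpFibre (labelsIndexing (domainGeometry R) (b13InnerData R)) act (stepOn (onSub S₀ M hMA hMB act) E₀ cB) W Aop →
      (∀ k g U Z ℓ, 0 ≤ Aop k g U Z ℓ) → (∀ k g U Z ℓ, 0 ≤ Aop' k g U Z ℓ) →
      (∀ k g U Z ℓ, Aop k g U Z ℓ ≤ Aop' k g U Z ℓ * Real.exp (-(κ * (R.carriers.d Z + 5)))) →
      (∀ k, ∀ g ∈ W, ∀ (U : R.carriers.BgB), ∀ Z ∈ R.domAt k,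
        actSum (b13InnerData R) (Aop' k g U) k Z ≤ εop * Real.exp (-(Rt * R.carriers.d Z))) →
      ActExpLinearOn (labelsIndexing (domainGeometry R) (b13InnerData R)) act Dt
        (ballClass (selfCtr (assemblyOn (onSub S₀ M hMA hMB act)).raw (assemblyOn (onSub S₀ M hMA hMB act)).histRef) ROp RHist) W →
      ActExpNormBound (labelsIndexing (domainGeometry R) (b13InnerData R)) Dt
        (ballClass (selfCtr (assemblyOn (onSub S₀ M hMA hMB act)).raw (assemblyOn (onSub S₀ M hMA hMB act)).histRef) ROp RHist) W
        S₀.rHist N →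
      (∀ k g U Z ℓ, 0 ≤ N k g U Z ℓ) → (∀ k g U Z ℓ, N k g U Z ℓ ≤ Nbar) →
      ActAbsBound (labelsIndexing (domainGeometry R) (b13InnerData R)) Dt
        (ballClass (selfCtr (assemblyOn (onSub S₀ M hMA hMB act)).raw (assemblyOn (onSub S₀ M hMA hMB act)).histRef) ROp RHist) W A →
      (∀ k g U Z ℓ, 0 ≤ A k g U Z ℓ) → (∀ k g U Z ℓ, 0 ≤ A' k g U Z ℓ) →
      (∀ k g U Z ℓ, A k g U Z ℓ ≤ A' k g U Z ℓ * Real.exp (-(κ * (R.carriers.d Z + 5)))) →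
      (∀ k, ∀ g ∈ W, ∀ (U : R.carriers.BgB), ∀ Z ∈ R.domAt k,
        actSum (b13InnerData R) (A' k g U) k Z ≤ ε * Real.exp (-(Rt * R.carriers.d Z))) →
      (∀ k, c₁ / r₀ * S₀.rOp k ≤ ROp k) → (∀ k, (assembly S₀).bHist E₀ cB k ≤ RHist k) →
      (∀ k, (Gi * δI / (1 - ρ₁) + 2 * Gi / θ ^ k₁) * S₀.rHist k + EA₀ * (S₀.rHist k * (cA / (1 - ω))) ≤ RHist k) →
      NE5 (B13StepOfRecordSub.outA (onSub S₀ M hMA hMB act) E₀ cB) (B13StepOfRecordSub.outB (onSub S₀ M hMA hMB act) E₀ cB) W κ θ'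
        C₅ := by
  obtain ⟨k₀, hk₀⟩ := reach_scale_exists (D := c₁ / r₀) (h := 0) (div_nonneg hc₁ hr₀.le) hθ1 hρ₀
  rw [add_zero] at hk₀
  refine ⟨((1 / (1 - ρ₀) * ((εop * Real.exp 64 * B12TreeDecay.K₀ (4 * 2 ^ 4) (2 * 4)) /
          (1 - 36 * (εop * Real.exp 64 * B12TreeDecay.K₀ (4 * 2 ^ 4) (2 * 4))) ^ 2)) * (c₁ / r₀) +
        2 * (Nbar * ((ε * Real.exp 64 * B12TreeDecay.K₀ (4 * 2 ^ 4) (2 * 4)) /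
          (1 - 36 * (ε * Real.exp 64 * B12TreeDecay.K₀ (4 * 2 ^ 4) (2 * 4))) ^ 2)) *
          (Gi * δI / (1 - ρ₁) + 2 * Gi / θ ^ k₁) + max 0 ((EA₀ + E₀) / θ ^ k₀)) * (θ' - ω) /
      (θ' - (ω + 2 * (Nbar * ((ε * Real.exp 64 * B12TreeDecay.K₀ (4 * 2 ^ 4) (2 * 4)) /
          (1 - 36 * (ε * Real.exp 64 * B12TreeDecay.K₀ (4 * 2 ^ 4) (2 * 4))) ^ 2)) * cA)), ?_⟩
  intro 𝔾 _ R E IOp Hist Ω _ _ _ _ _ _ S₀ M hMA hMB act W ROp RHist N A A' Aop Aop' Dt rI hrI Cfg _ _ cfg Φ 𝒪 Dc hSω hT hbB hbA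
    hdA hdB hRA hRB hwer hfl hcomp hIA hirate hfib hAop0 hAop0' hdecop h238op hexp hN hN0 hNle habs hA0 hA0' hdec h238 hOp hHist hHistA
  subst hSω
  exact ne5_of_record_onSub_secant_structural S₀ M hMA hMB act E₀ cB rI hrI hT hbB hbA hdA hdB hRA hRB hwer hfl hcomp hIA hirate hδI
    hGi hρ₁ hreachI hfib hAop0 hAop0' hdecop hεop h238op hΦopsmall hexp hN hN0 hNle hNbar habs hA0 hA0' hκ hdec hε h238 hRt hΦsmall hOp
    hHist hHistA hEA₀ hE₀ one_pos hcA hcB hc₁ hr₀ hθ0 hθθ' hθ'1 hω hω1 hρ₀.le hρ₀1 hk₀ (le_max_left _ _)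
    (fun k hk => OutputRateResidual.first_scales_const hθ0 hθ1.le hk.le) hsmall

end OnSub

/-! ## §2 E8[rec,structural] re-pointed (R20): the cores OF RECORD through the inclusion — root on the outputs of record -/

section Restrict

/-- [folklore] **THE STRUCTURAL SECANT END OF RECORD RE-POINTED OVER A SUB-SLOT, WITH A CONSTANT UNIFORM IN THE PAIR OF RUNS AND IN
THE SUB-SLOT — ROOT ON THE OUTPUTS OF RECORD.**  Sizes and the one strict size inequality as in §1.  Then ONE constant `C₅` serves EVERY
pair of runs `R`, slot package of record `S₀` (`S₀.D.ω = ω`), ℂ-submodule `M ≤ OpDatum E` CONTAINING BOTH RUNS' OPERATOR DATA OF RECORD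
(of record `M := measOp`, membership by leaf-03's `opA_mem_measOp` ∕ `opB_mem_measOp`), window, class radii, majorants, datum, insertion
radii and insertion-composition data: the displayed binders of `B13StepOfRecordSecantStructuralSub.ne5_of_record_restrict_secant_structural`
— reading, slice budgets, the quoted levels L05∕L06 for `B13StepOfRecord.outA∕outB S₀ E₀ cB`, W1 in row NE2's entry currency + floor, the
insertion composition shape + datum membership + insertion rate, **`ActOpFibre` for the cores OF RECORD read through the inclusion over
operator lines IN `M`** with decay split + (2.38) shape, the history side's per-activity data on the sub-slot ball class, radii — IMPLY
`NE5 (B13StepOfRecord.outA S₀ E₀ cB) (B13StepOfRecord.outB S₀ E₀ cB) W κ θ′ C₅`: the `∃`-OUTERMOST form the structural secant END lacked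
(p214566 §3 ∕ p217039 §5 have `∃ C₅` after the window).  NOT a proof of NE5: an implication from displayed binders. -/
theorem uniform_ne5_of_record_restrict_secant_structural {κ Nbar ε εop Rt EA₀ E₀ cA cB c₁ r₀ Gi δI ρ₁ θ θ' ω ρ₀ : ℝ} {k₁ : ℕ}
    (hκ : 0 ≤ κ) (hNbar : 0 ≤ Nbar) (hε : 0 ≤ ε) (hεop : 0 ≤ εop) (hRt : 64 * Real.log 162 + 64 ≤ Rt)
    (hΦsmall : 36 * (ε * Real.exp 64 * B12TreeDecay.K₀ (4 * 2 ^ 4) (2 * 4)) < 1)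
    (hΦopsmall : 36 * (εop * Real.exp 64 * B12TreeDecay.K₀ (4 * 2 ^ 4) (2 * 4)) < 1)
    (hEA₀ : 0 ≤ EA₀) (hE₀ : 0 ≤ E₀) (hcA : 0 ≤ cA) (hcB : 0 ≤ cB) (hc₁ : 0 ≤ c₁) (hr₀ : 0 < r₀)
    (hGi : 0 ≤ Gi) (hδI : 0 ≤ δI) (hρ₁ : ρ₁ < 1) (hreachI : δI * θ ^ k₁ ≤ ρ₁)
    (hθ0 : 0 < θ) (hθ1 : θ < 1) (hθθ' : θ ≤ θ') (hθ'1 : θ' ≤ 1) (hω : 0 < ω) (hω1 : ω < 1) (hρ₀ : 0 < ρ₀) (hρ₀1 : ρ₀ < 1)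
    (hsmall : ω + 2 * (Nbar * ((ε * Real.exp 64 * B12TreeDecay.K₀ (4 * 2 ^ 4) (2 * 4)) /
          (1 - 36 * (ε * Real.exp 64 * B12TreeDecay.K₀ (4 * 2 ^ 4) (2 * 4))) ^ 2)) * cA < θ') :
    ∃ C₅ : ℝ, ∀ {𝔾 : Type} [GaugeGroup 𝔾] {R : TwoRuns 𝔾} {E IOp Hist Ω : Type*} [NormedAddCommGroup Hist] [NormedSpace ℂ Hist]
      [CompleteSpace Hist] [NormedAddCommGroup IOp] [NormedSpace ℂ IOp] [MeasurableSpace Ω] (S₀ : Slots R E IOp Hist)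
      (M : Submodule ℂ (OpDatum E)) (hMA : ∀ g V k, opOf S₀.F S₀.rawA g V k ∈ M) (hMB : ∀ g U k, opOf S₀.F S₀.rawB g U k ∈ M)
      {W : Set (ℕ → ℝ)} {ROp RHist : ℕ → ℝ}
      {N A A' Aop Aop' : ℕ → (ℕ → ℝ) → R.carriers.BgB → R.carriers.Dom → InnerLabel R.carriers.Dom (Bnd R) → ℝ}
      {Dt : ActData R.carriers.Dom (InnerLabel R.carriers.Dom (Bnd R)) M Hist Ω} {rI : ℕ → ℝ} {hrI : ∀ k, 0 < rI k}
      {Cfg : ℕ → Type*} [∀ k, NormedAddCommGroup (Cfg k)] [∀ k, NormedSpace ℂ (Cfg k)] {cfg : ∀ k, IOp → Cfg k}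
      {Φ : ∀ k, (R.carriers.Dom → ℝ) → Cfg k → Hist} {𝒪 : ℕ → (ℕ → ℝ) → R.carriers.BgB → Set IOp}
      {Dc : ∀ k, (ℕ → ℝ) → R.carriers.BgB → Set (Cfg k)},
      S₀.D.ω = ω →
      (assembly S₀).TransportReads W →
      (assembly S₀).SliceBudgetB W κ cB → S₀.D.SliceBudget (step S₀ E₀ cB) W κ cA →
      DecayBound (B13StepOfRecord.outA S₀ E₀ cB) W EA₀ κ → DecayBound (B13StepOfRecord.outB S₀ E₀ cB) W E₀ κ →
      RawBounded S₀.F (assembly S₀).rawAt W → RawBounded S₀.F S₀.rawB W →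
      WeightedEntrywiseRate S₀.F (assembly S₀).rawAt S₀.rawB W c₁ (fun k => θ ^ k) → (∀ k, r₀ ≤ S₀.rOp k) →
      InsOpComposition (S₀.D.toInsOpModel (step S₀ E₀ cB) rI hrI) W κ E₀ Gi cfg Φ 𝒪 Dc →
      (∀ k, ∀ g ∈ W, ∀ (U : R.carriers.BgB), (S₀.D.toInsOpModel (step S₀ E₀ cB) rI hrI).opIA g U k ∈ 𝒪 k g U) →
      (S₀.D.toInsOpModel (step S₀ E₀ cB) rI hrI).InsOpRate W δI θ →
      ActOpFibre (labelsIndexing (domainGeometry R) (b13InnerData R)) (restrict S₀ M hMA hMB).act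
        (stepOn (restrict S₀ M hMA hMB) E₀ cB) W Aop →
      (∀ k g U Z ℓ, 0 ≤ Aop k g U Z ℓ) → (∀ k g U Z ℓ, 0 ≤ Aop' k g U Z ℓ) →
      (∀ k g U Z ℓ, Aop k g U Z ℓ ≤ Aop' k g U Z ℓ * Real.exp (-(κ * (R.carriers.d Z + 5)))) →
      (∀ k, ∀ g ∈ W, ∀ (U : R.carriers.BgB), ∀ Z ∈ R.domAt k,
        actSum (b13InnerData R) (Aop' k g U) k Z ≤ εop * Real.exp (-(Rt * R.carriers.d Z))) →
      ActExpLinearOn (labelsIndexing (domainGeometry R) (b13InnerData R)) (restrict S₀ M hMA hMB).act Dt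
        (ballClass (selfCtr (assemblyOn (restrict S₀ M hMA hMB)).raw (assemblyOn (restrict S₀ M hMA hMB)).histRef) ROp RHist) W →
      ActExpNormBound (labelsIndexing (domainGeometry R) (b13InnerData R)) Dt
        (ballClass (selfCtr (assemblyOn (restrict S₀ M hMA hMB)).raw (assemblyOn (restrict S₀ M hMA hMB)).histRef) ROp RHist) W
        S₀.rHist N →
      (∀ k g U Z ℓ, 0 ≤ N k g U Z ℓ) → (∀ k g U Z ℓ, N k g U Z ℓ ≤ Nbar) →
      ActAbsBound (labelsIndexing (domainGeometry R) (b13InnerData R)) Dt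
        (ballClass (selfCtr (assemblyOn (restrict S₀ M hMA hMB)).raw (assemblyOn (restrict S₀ M hMA hMB)).histRef) ROp RHist) W A →
      (∀ k g U Z ℓ, 0 ≤ A k g U Z ℓ) → (∀ k g U Z ℓ, 0 ≤ A' k g U Z ℓ) →
      (∀ k g U Z ℓ, A k g U Z ℓ ≤ A' k g U Z ℓ * Real.exp (-(κ * (R.carriers.d Z + 5)))) →
      (∀ k, ∀ g ∈ W, ∀ (U : R.carriers.BgB), ∀ Z ∈ R.domAt k,
        actSum (b13InnerData R) (A' k g U) k Z ≤ ε * Real.exp (-(Rt * R.carriers.d Z))) →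
      (∀ k, c₁ / r₀ * S₀.rOp k ≤ ROp k) → (∀ k, (assembly S₀).bHist E₀ cB k ≤ RHist k) →
      (∀ k, (Gi * δI / (1 - ρ₁) + 2 * Gi / θ ^ k₁) * S₀.rHist k + EA₀ * (S₀.rHist k * (cA / (1 - ω))) ≤ RHist k) →
      NE5 (B13StepOfRecord.outA S₀ E₀ cB) (B13StepOfRecord.outB S₀ E₀ cB) W κ θ' C₅ := by
  obtain ⟨k₀, hk₀⟩ := reach_scale_exists (D := c₁ / r₀) (h := 0) (div_nonneg hc₁ hr₀.le) hθ1 hρ₀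
  rw [add_zero] at hk₀
  refine ⟨((1 / (1 - ρ₀) * ((εop * Real.exp 64 * B12TreeDecay.K₀ (4 * 2 ^ 4) (2 * 4)) /
          (1 - 36 * (εop * Real.exp 64 * B12TreeDecay.K₀ (4 * 2 ^ 4) (2 * 4))) ^ 2)) * (c₁ / r₀) +
        2 * (Nbar * ((ε * Real.exp 64 * B12TreeDecay.K₀ (4 * 2 ^ 4) (2 * 4)) /
          (1 - 36 * (ε * Real.exp 64 * B12TreeDecay.K₀ (4 * 2 ^ 4) (2 * 4))) ^ 2)) *
          (Gi * δI / (1 - ρ₁) + 2 * Gi / θ ^ k₁) + max 0 ((EA₀ + E₀) / θ ^ k₀)) * (θ' - ω) /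
      (θ' - (ω + 2 * (Nbar * ((ε * Real.exp 64 * B12TreeDecay.K₀ (4 * 2 ^ 4) (2 * 4)) /
          (1 - 36 * (ε * Real.exp 64 * B12TreeDecay.K₀ (4 * 2 ^ 4) (2 * 4))) ^ 2)) * cA)), ?_⟩
  intro 𝔾 _ R E IOp Hist Ω _ _ _ _ _ _ S₀ M hMA hMB W ROp RHist N A A' Aop Aop' Dt rI hrI Cfg _ _ cfg Φ 𝒪 Dc hSω hT hbB hbA hdA hdB
    hRA hRB hwer hfl hcomp hIA hirate hfib hAop0 hAop0' hdecop h238op hexp hN hN0 hNle habs hA0 hA0' hdec h238 hOp hHist hHistA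
  subst hSω
  exact ne5_of_record_restrict_secant_structural S₀ M hMA hMB E₀ cB rI hrI hT hbB hbA hdA hdB hRA hRB hwer hfl hcomp hIA hirate hδI
    hGi hρ₁ hreachI hfib hAop0 hAop0' hdecop hεop h238op hΦopsmall hexp hN hN0 hNle hNbar habs hA0 hA0' hκ hdec hε h238 hRt hΦsmall hOp
    hHist hHistA hEA₀ hE₀ one_pos hcA hcB hc₁ hr₀ hθ0 hθθ' hθ'1 hω hω1 hρ₀.le hρ₀1 hk₀ (le_max_left _ _)
    (fun k hk => OutputRateResidual.first_scales_const hθ0 hθ1.le hk.le) hsmall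

/-- [folklore] **THE SAME, FROM THE CAUCHY ROUTE's FACTOR DATUM OVER `↥M`** (η-uniform form of p217039 §4
`ne5_of_record_restrict_secant_lineAnalytic`): the operator binder is ROOM (`rOp ≤ ROp`, `bHist + rHist ≤ RHist`), the activity norm
majorant `Aop` of the cores of record on the sub-slot ball class and **`ActOpLineAnalyticOn … (restrict …).act (ballClass …) W`** — the ONE
W2-op binder leaf-03's η-uniform E9[rec,sub] face `B13StepEnvelopeEndUniform.uniform_ne5_of_record_restrict_envelope` reads too — in place of
`ActOpFibre`; every other binder and the constant as in `uniform_ne5_of_record_restrict_secant_structural`.  NOT a proof of NE5. -/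
theorem uniform_ne5_of_record_restrict_secant_lineAnalytic {κ Nbar ε εop Rt EA₀ E₀ cA cB c₁ r₀ Gi δI ρ₁ θ θ' ω ρ₀ : ℝ} {k₁ : ℕ}
    (hκ : 0 ≤ κ) (hNbar : 0 ≤ Nbar) (hε : 0 ≤ ε) (hεop : 0 ≤ εop) (hRt : 64 * Real.log 162 + 64 ≤ Rt)
    (hΦsmall : 36 * (ε * Real.exp 64 * B12TreeDecay.K₀ (4 * 2 ^ 4) (2 * 4)) < 1)
    (hΦopsmall : 36 * (εop * Real.exp 64 * B12TreeDecay.K₀ (4 * 2 ^ 4) (2 * 4)) < 1)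
    (hEA₀ : 0 ≤ EA₀) (hE₀ : 0 ≤ E₀) (hcA : 0 ≤ cA) (hcB : 0 ≤ cB) (hc₁ : 0 ≤ c₁) (hr₀ : 0 < r₀)
    (hGi : 0 ≤ Gi) (hδI : 0 ≤ δI) (hρ₁ : ρ₁ < 1) (hreachI : δI * θ ^ k₁ ≤ ρ₁)
    (hθ0 : 0 < θ) (hθ1 : θ < 1) (hθθ' : θ ≤ θ') (hθ'1 : θ' ≤ 1) (hω : 0 < ω) (hω1 : ω < 1) (hρ₀ : 0 < ρ₀) (hρ₀1 : ρ₀ < 1)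
    (hsmall : ω + 2 * (Nbar * ((ε * Real.exp 64 * B12TreeDecay.K₀ (4 * 2 ^ 4) (2 * 4)) /
          (1 - 36 * (ε * Real.exp 64 * B12TreeDecay.K₀ (4 * 2 ^ 4) (2 * 4))) ^ 2)) * cA < θ') :
    ∃ C₅ : ℝ, ∀ {𝔾 : Type} [GaugeGroup 𝔾] {R : TwoRuns 𝔾} {E IOp Hist Ω : Type*} [NormedAddCommGroup Hist] [NormedSpace ℂ Hist]
      [CompleteSpace Hist] [NormedAddCommGroup IOp] [NormedSpace ℂ IOp] [MeasurableSpace Ω] (S₀ : Slots R E IOp Hist)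
      (M : Submodule ℂ (OpDatum E)) (hMA : ∀ g V k, opOf S₀.F S₀.rawA g V k ∈ M) (hMB : ∀ g U k, opOf S₀.F S₀.rawB g U k ∈ M)
      {W : Set (ℕ → ℝ)} {ROp RHist : ℕ → ℝ}
      {N A A' Aop Aop' : ℕ → (ℕ → ℝ) → R.carriers.BgB → R.carriers.Dom → InnerLabel R.carriers.Dom (Bnd R) → ℝ}
      {Dt : ActData R.carriers.Dom (InnerLabel R.carriers.Dom (Bnd R)) M Hist Ω} {rI : ℕ → ℝ} {hrI : ∀ k, 0 < rI k}
      {Cfg : ℕ → Type*} [∀ k, NormedAddCommGroup (Cfg k)] [∀ k, NormedSpace ℂ (Cfg k)] {cfg : ∀ k, IOp → Cfg k}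
      {Φ : ∀ k, (R.carriers.Dom → ℝ) → Cfg k → Hist} {𝒪 : ℕ → (ℕ → ℝ) → R.carriers.BgB → Set IOp}
      {Dc : ∀ k, (ℕ → ℝ) → R.carriers.BgB → Set (Cfg k)},
      S₀.D.ω = ω →
      (assembly S₀).TransportReads W →
      (assembly S₀).SliceBudgetB W κ cB → S₀.D.SliceBudget (step S₀ E₀ cB) W κ cA →
      DecayBound (B13StepOfRecord.outA S₀ E₀ cB) W EA₀ κ → DecayBound (B13StepOfRecord.outB S₀ E₀ cB) W E₀ κ →
      RawBounded S₀.F (assembly S₀).rawAt W → RawBounded S₀.F S₀.rawB W →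
      WeightedEntrywiseRate S₀.F (assembly S₀).rawAt S₀.rawB W c₁ (fun k => θ ^ k) → (∀ k, r₀ ≤ S₀.rOp k) →
      InsOpComposition (S₀.D.toInsOpModel (step S₀ E₀ cB) rI hrI) W κ E₀ Gi cfg Φ 𝒪 Dc →
      (∀ k, ∀ g ∈ W, ∀ (U : R.carriers.BgB), (S₀.D.toInsOpModel (step S₀ E₀ cB) rI hrI).opIA g U k ∈ 𝒪 k g U) →
      (S₀.D.toInsOpModel (step S₀ E₀ cB) rI hrI).InsOpRate W δI θ →
      (∀ k, S₀.rOp k ≤ ROp k) → (∀ k, (assembly S₀).bHist E₀ cB k + S₀.rHist k ≤ RHist k) →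
      (∀ k, ∀ g ∈ W, ∀ (U : R.carriers.BgB) (q : M × Hist),
        q ∈ ballClass (selfCtr (assemblyOn (restrict S₀ M hMA hMB)).raw (assemblyOn (restrict S₀ M hMA hMB)).histRef) ROp RHist k g U →
          ∀ X : R.carriers.Dom, R.carriers.scale X = k → ∀ i, (labelsIndexing (domainGeometry R) (b13InnerData R)).Rel k i X → ∀ m,
            ‖S₀.act ((labelsIndexing (domainGeometry R) (b13InnerData R)).poly i m)
                ((labelsIndexing (domainGeometry R) (b13InnerData R)).lab i m) (q.1 : OpDatum E) q.2‖ ≤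
              Aop k g U ((labelsIndexing (domainGeometry R) (b13InnerData R)).poly i m)
                ((labelsIndexing (domainGeometry R) (b13InnerData R)).lab i m)) →
      ActOpLineAnalyticOn (labelsIndexing (domainGeometry R) (b13InnerData R)) (restrict S₀ M hMA hMB).act
        (ballClass (selfCtr (assemblyOn (restrict S₀ M hMA hMB)).raw (assemblyOn (restrict S₀ M hMA hMB)).histRef) ROp RHist) W →
      (∀ k g U Z ℓ, 0 ≤ Aop k g U Z ℓ) → (∀ k g U Z ℓ, 0 ≤ Aop' k g U Z ℓ) →
      (∀ k g U Z ℓ, Aop k g U Z ℓ ≤ Aop' k g U Z ℓ * Real.exp (-(κ * (R.carriers.d Z + 5)))) →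
      (∀ k, ∀ g ∈ W, ∀ (U : R.carriers.BgB), ∀ Z ∈ R.domAt k,
        actSum (b13InnerData R) (Aop' k g U) k Z ≤ εop * Real.exp (-(Rt * R.carriers.d Z))) →
      ActExpLinearOn (labelsIndexing (domainGeometry R) (b13InnerData R)) (restrict S₀ M hMA hMB).act Dt
        (ballClass (selfCtr (assemblyOn (restrict S₀ M hMA hMB)).raw (assemblyOn (restrict S₀ M hMA hMB)).histRef) ROp RHist) W →
      ActExpNormBound (labelsIndexing (domainGeometry R) (b13InnerData R)) Dt
        (ballClass (selfCtr (assemblyOn (restrict S₀ M hMA hMB)).raw (assemblyOn (restrict S₀ M hMA hMB)).histRef) ROp RHist) W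
        S₀.rHist N →
      (∀ k g U Z ℓ, 0 ≤ N k g U Z ℓ) → (∀ k g U Z ℓ, N k g U Z ℓ ≤ Nbar) →
      ActAbsBound (labelsIndexing (domainGeometry R) (b13InnerData R)) Dt
        (ballClass (selfCtr (assemblyOn (restrict S₀ M hMA hMB)).raw (assemblyOn (restrict S₀ M hMA hMB)).histRef) ROp RHist) W A →
      (∀ k g U Z ℓ, 0 ≤ A k g U Z ℓ) → (∀ k g U Z ℓ, 0 ≤ A' k g U Z ℓ) →
      (∀ k g U Z ℓ, A k g U Z ℓ ≤ A' k g U Z ℓ * Real.exp (-(κ * (R.carriers.d Z + 5)))) →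
      (∀ k, ∀ g ∈ W, ∀ (U : R.carriers.BgB), ∀ Z ∈ R.domAt k,
        actSum (b13InnerData R) (A' k g U) k Z ≤ ε * Real.exp (-(Rt * R.carriers.d Z))) →
      (∀ k, c₁ / r₀ * S₀.rOp k ≤ ROp k) → (∀ k, (assembly S₀).bHist E₀ cB k ≤ RHist k) →
      (∀ k, (Gi * δI / (1 - ρ₁) + 2 * Gi / θ ^ k₁) * S₀.rHist k + EA₀ * (S₀.rHist k * (cA / (1 - ω))) ≤ RHist k) →
      NE5 (B13StepOfRecord.outA S₀ E₀ cB) (B13StepOfRecord.outB S₀ E₀ cB) W κ θ' C₅ := by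
  obtain ⟨k₀, hk₀⟩ := reach_scale_exists (D := c₁ / r₀) (h := 0) (div_nonneg hc₁ hr₀.le) hθ1 hρ₀
  rw [add_zero] at hk₀
  refine ⟨((1 / (1 - ρ₀) * ((εop * Real.exp 64 * B12TreeDecay.K₀ (4 * 2 ^ 4) (2 * 4)) /
          (1 - 36 * (εop * Real.exp 64 * B12TreeDecay.K₀ (4 * 2 ^ 4) (2 * 4))) ^ 2)) * (c₁ / r₀) +
        2 * (Nbar * ((ε * Real.exp 64 * B12TreeDecay.K₀ (4 * 2 ^ 4) (2 * 4)) /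
          (1 - 36 * (ε * Real.exp 64 * B12TreeDecay.K₀ (4 * 2 ^ 4) (2 * 4))) ^ 2)) *
          (Gi * δI / (1 - ρ₁) + 2 * Gi / θ ^ k₁) + max 0 ((EA₀ + E₀) / θ ^ k₀)) * (θ' - ω) /
      (θ' - (ω + 2 * (Nbar * ((ε * Real.exp 64 * B12TreeDecay.K₀ (4 * 2 ^ 4) (2 * 4)) /
          (1 - 36 * (ε * Real.exp 64 * B12TreeDecay.K₀ (4 * 2 ^ 4) (2 * 4))) ^ 2)) * cA)), ?_⟩
  intro 𝔾 _ R E IOp Hist Ω _ _ _ _ _ _ S₀ M hMA hMB W ROp RHist N A A' Aop Aop' Dt rI hrI Cfg _ _ cfg Φ 𝒪 Dc hSω hT hbB hbA hdA hdB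
    hRA hRB hwer hfl hcomp hIA hirate hOp' hHist' hAK hact hAop0 hAop0' hdecop h238op hexp hN hN0 hNle habs hA0 hA0' hdec h238 hOp
    hHist hHistA
  subst hSω
  exact ne5_of_record_restrict_secant_lineAnalytic S₀ M hMA hMB E₀ cB rI hrI hT hbB hbA hdA hdB hRA hRB hwer hfl hcomp hIA hirate hδI
    hGi hρ₁ hreachI hOp' hHist' hAK hact hAop0 hAop0' hdecop hεop h238op hΦopsmall hexp hN hN0 hNle hNbar habs hA0 hA0' hκ hdec hε
    h238 hRt hΦsmall hOp hHist hHistA hEA₀ hE₀ one_pos hcA hcB hc₁ hr₀ hθ0 hθθ' hθ'1 hω hω1 hρ₀.le hρ₀1 hk₀ (le_max_left _ _)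
    (fun k hk => OutputRateResidual.first_scales_const hθ0 hθ1.le hk.le) hsmall

end Restrict

/-! ## §3 Windowwise (R24 × R29′): g-indexed dictionaries and insertion-composition data, the SAME constant -/

section Windowwise

/-- [folklore] **THE STRUCTURAL SECANT END OF RECORD RE-POINTED, η-UNIFORM AND g-UNIFORM ACROSS SINGLETON WINDOWS.**  §2's
`uniform_ne5_of_record_restrict_secant_structural` read WINDOWWISE: ONE `C₅` from the sizes such that for every pair of runs, slot package
(`S₀.D.ω = ω`), sub-slot `M ∋` the data of record, window `W` AND EVERY COUPLING `g ∈ W` SEPARATELY — each window-dependent displayed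
binder supplied at the singleton window `{g}` with g-INDEXED majorants `N g, A g, A′ g, Aop g, Aop′ g`, datum `Dt g` and
insertion-composition data `cfg g, Φ g, 𝒪 g, Dc g` (COMMON sizes and radii; R24's «g-indexed dictionaries on singleton windows») —
`NE5 (B13StepOfRecord.outA S₀ E₀ cB) (B13StepOfRecord.outB S₀ E₀ cB) W κ θ′ C₅` (`OutputRateWindow.ne5_of_forall_singleton`; R29′ (a):
`∃ C₅` OUTERMOST, no cost in the constant).  NOT a proof of NE5. -/
theorem uniform_ne5_of_record_restrict_secant_structural_singleton {κ Nbar ε εop Rt EA₀ E₀ cA cB c₁ r₀ Gi δI ρ₁ θ θ' ω ρ₀ : ℝ} {k₁ : ℕ}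
    (hκ : 0 ≤ κ) (hNbar : 0 ≤ Nbar) (hε : 0 ≤ ε) (hεop : 0 ≤ εop) (hRt : 64 * Real.log 162 + 64 ≤ Rt)
    (hΦsmall : 36 * (ε * Real.exp 64 * B12TreeDecay.K₀ (4 * 2 ^ 4) (2 * 4)) < 1)
    (hΦopsmall : 36 * (εop * Real.exp 64 * B12TreeDecay.K₀ (4 * 2 ^ 4) (2 * 4)) < 1)
    (hEA₀ : 0 ≤ EA₀) (hE₀ : 0 ≤ E₀) (hcA : 0 ≤ cA) (hcB : 0 ≤ cB) (hc₁ : 0 ≤ c₁) (hr₀ : 0 < r₀)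
    (hGi : 0 ≤ Gi) (hδI : 0 ≤ δI) (hρ₁ : ρ₁ < 1) (hreachI : δI * θ ^ k₁ ≤ ρ₁)
    (hθ0 : 0 < θ) (hθ1 : θ < 1) (hθθ' : θ ≤ θ') (hθ'1 : θ' ≤ 1) (hω : 0 < ω) (hω1 : ω < 1) (hρ₀ : 0 < ρ₀) (hρ₀1 : ρ₀ < 1)
    (hsmall : ω + 2 * (Nbar * ((ε * Real.exp 64 * B12TreeDecay.K₀ (4 * 2 ^ 4) (2 * 4)) /
          (1 - 36 * (ε * Real.exp 64 * B12TreeDecay.K₀ (4 * 2 ^ 4) (2 * 4))) ^ 2)) * cA < θ') :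
    ∃ C₅ : ℝ, ∀ {𝔾 : Type} [GaugeGroup 𝔾] {R : TwoRuns 𝔾} {E IOp Hist Ω : Type*} [NormedAddCommGroup Hist] [NormedSpace ℂ Hist]
      [CompleteSpace Hist] [NormedAddCommGroup IOp] [NormedSpace ℂ IOp] [MeasurableSpace Ω] (S₀ : Slots R E IOp Hist)
      (M : Submodule ℂ (OpDatum E)) (hMA : ∀ g V k, opOf S₀.F S₀.rawA g V k ∈ M) (hMB : ∀ g U k, opOf S₀.F S₀.rawB g U k ∈ M)
      {W : Set (ℕ → ℝ)} {ROp RHist : ℕ → ℝ}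
      {N A A' Aop Aop' : (ℕ → ℝ) → ℕ → (ℕ → ℝ) → R.carriers.BgB → R.carriers.Dom → InnerLabel R.carriers.Dom (Bnd R) → ℝ}
      {Dt : (ℕ → ℝ) → ActData R.carriers.Dom (InnerLabel R.carriers.Dom (Bnd R)) M Hist Ω} {rI : ℕ → ℝ} {hrI : ∀ k, 0 < rI k}
      {Cfg : ℕ → Type*} [∀ k, NormedAddCommGroup (Cfg k)] [∀ k, NormedSpace ℂ (Cfg k)] {cfg : (ℕ → ℝ) → ∀ k, IOp → Cfg k}
      {Φ : (ℕ → ℝ) → ∀ k, (R.carriers.Dom → ℝ) → Cfg k → Hist} {𝒪 : (ℕ → ℝ) → ℕ → (ℕ → ℝ) → R.carriers.BgB → Set IOp}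
      {Dc : (ℕ → ℝ) → ∀ k, (ℕ → ℝ) → R.carriers.BgB → Set (Cfg k)},
      S₀.D.ω = ω →
      (∀ g ∈ W, (assembly S₀).TransportReads {g}) →
      (∀ g ∈ W, (assembly S₀).SliceBudgetB {g} κ cB) → (∀ g ∈ W, S₀.D.SliceBudget (step S₀ E₀ cB) {g} κ cA) →
      (∀ g ∈ W, DecayBound (B13StepOfRecord.outA S₀ E₀ cB) {g} EA₀ κ) →
      (∀ g ∈ W, DecayBound (B13StepOfRecord.outB S₀ E₀ cB) {g} E₀ κ) →
      (∀ g ∈ W, RawBounded S₀.F (assembly S₀).rawAt {g}) → (∀ g ∈ W, RawBounded S₀.F S₀.rawB {g}) →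
      (∀ g ∈ W, WeightedEntrywiseRate S₀.F (assembly S₀).rawAt S₀.rawB {g} c₁ (fun k => θ ^ k)) → (∀ k, r₀ ≤ S₀.rOp k) →
      (∀ g ∈ W, InsOpComposition (S₀.D.toInsOpModel (step S₀ E₀ cB) rI hrI) {g} κ E₀ Gi (cfg g) (Φ g) (𝒪 g) (Dc g)) →
      (∀ g ∈ W, ∀ k, ∀ g' ∈ ({g} : Set (ℕ → ℝ)), ∀ (U : R.carriers.BgB),
        (S₀.D.toInsOpModel (step S₀ E₀ cB) rI hrI).opIA g' U k ∈ 𝒪 g k g' U) →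
      (∀ g ∈ W, (S₀.D.toInsOpModel (step S₀ E₀ cB) rI hrI).InsOpRate {g} δI θ) →
      (∀ g ∈ W, ActOpFibre (labelsIndexing (domainGeometry R) (b13InnerData R)) (restrict S₀ M hMA hMB).act
        (stepOn (restrict S₀ M hMA hMB) E₀ cB) {g} (Aop g)) →
      (∀ g ∈ W, ∀ k g' U Z ℓ, 0 ≤ Aop g k g' U Z ℓ) → (∀ g ∈ W, ∀ k g' U Z ℓ, 0 ≤ Aop' g k g' U Z ℓ) →
      (∀ g ∈ W, ∀ k g' U Z ℓ, Aop g k g' U Z ℓ ≤ Aop' g k g' U Z ℓ * Real.exp (-(κ * (R.carriers.d Z + 5)))) →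
      (∀ g ∈ W, ∀ k, ∀ g' ∈ ({g} : Set (ℕ → ℝ)), ∀ (U : R.carriers.BgB), ∀ Z ∈ R.domAt k,
        actSum (b13InnerData R) (Aop' g k g' U) k Z ≤ εop * Real.exp (-(Rt * R.carriers.d Z))) →
      (∀ g ∈ W, ActExpLinearOn (labelsIndexing (domainGeometry R) (b13InnerData R)) (restrict S₀ M hMA hMB).act (Dt g)
        (ballClass (selfCtr (assemblyOn (restrict S₀ M hMA hMB)).raw (assemblyOn (restrict S₀ M hMA hMB)).histRef) ROp RHist) {g}) →
      (∀ g ∈ W, ActExpNormBound (labelsIndexing (domainGeometry R) (b13InnerData R)) (Dt g)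
        (ballClass (selfCtr (assemblyOn (restrict S₀ M hMA hMB)).raw (assemblyOn (restrict S₀ M hMA hMB)).histRef) ROp RHist) {g}
        S₀.rHist (N g)) →
      (∀ g ∈ W, ∀ k g' U Z ℓ, 0 ≤ N g k g' U Z ℓ) → (∀ g ∈ W, ∀ k g' U Z ℓ, N g k g' U Z ℓ ≤ Nbar) →
      (∀ g ∈ W, ActAbsBound (labelsIndexing (domainGeometry R) (b13InnerData R)) (Dt g)
        (ballClass (selfCtr (assemblyOn (restrict S₀ M hMA hMB)).raw (assemblyOn (restrict S₀ M hMA hMB)).histRef) ROp RHist) {g}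
        (A g)) →
      (∀ g ∈ W, ∀ k g' U Z ℓ, 0 ≤ A g k g' U Z ℓ) → (∀ g ∈ W, ∀ k g' U Z ℓ, 0 ≤ A' g k g' U Z ℓ) →
      (∀ g ∈ W, ∀ k g' U Z ℓ, A g k g' U Z ℓ ≤ A' g k g' U Z ℓ * Real.exp (-(κ * (R.carriers.d Z + 5)))) →
      (∀ g ∈ W, ∀ k, ∀ g' ∈ ({g} : Set (ℕ → ℝ)), ∀ (U : R.carriers.BgB), ∀ Z ∈ R.domAt k,
        actSum (b13InnerData R) (A' g k g' U) k Z ≤ ε * Real.exp (-(Rt * R.carriers.d Z))) →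
      (∀ k, c₁ / r₀ * S₀.rOp k ≤ ROp k) → (∀ k, (assembly S₀).bHist E₀ cB k ≤ RHist k) →
      (∀ k, (Gi * δI / (1 - ρ₁) + 2 * Gi / θ ^ k₁) * S₀.rHist k + EA₀ * (S₀.rHist k * (cA / (1 - ω))) ≤ RHist k) →
      NE5 (B13StepOfRecord.outA S₀ E₀ cB) (B13StepOfRecord.outB S₀ E₀ cB) W κ θ' C₅ := by
  obtain ⟨C₅, h⟩ :=
    uniform_ne5_of_record_restrict_secant_structural (κ := κ) (k₁ := k₁) hκ hNbar hε hεop hRt hΦsmall hΦopsmall hEA₀ hE₀ hcA hcB hc₁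
      hr₀ hGi hδI hρ₁ hreachI hθ0 hθ1 hθθ' hθ'1 hω hω1 hρ₀ hρ₀1 hsmall
  refine ⟨C₅, ?_⟩
  intro 𝔾 _ R E IOp Hist Ω _ _ _ _ _ _ S₀ M hMA hMB W ROp RHist N A A' Aop Aop' Dt rI hrI Cfg _ _ cfg Φ 𝒪 Dc hSω hT hbB hbA hdA hdB
    hRA hRB hwer hfl hcomp hIA hirate hfib hAop0 hAop0' hdecop h238op hexp hN hN0 hNle habs hA0 hA0' hdec h238 hOp hHist hHistA
  exact ne5_of_forall_singleton fun g hg =>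
    h S₀ M hMA hMB hSω (hT g hg) (hbB g hg) (hbA g hg) (hdA g hg) (hdB g hg) (hRA g hg) (hRB g hg) (hwer g hg) hfl (hcomp g hg)
      (hIA g hg) (hirate g hg) (hfib g hg) (hAop0 g hg) (hAop0' g hg) (hdecop g hg) (h238op g hg) (hexp g hg) (hN g hg) (hN0 g hg)
      (hNle g hg) (habs g hg) (hA0 g hg) (hA0' g hg) (hdec g hg) (h238 g hg) hOp hHist hHistA

end Windowwise

end Summit.QuantumFields.BalabanUV.T4Continuum.B13StepOfRecordSecantStructuralUniform

end
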